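import Literature.NumberTheory.GelbartRogawski1991.CMThetaTypeVocabulary
import Literature.NumberTheory.Automorphic.UnitaryGroupDualPairLocalLine
import HarnessLib

/-!
# Crux `H413`, programme P2, line `F0_P2GR91NJacquet` (#76 U′-N local pay-down) — AUDIT K0: the centre of `U(diag dV)(L⁺_v)` acts on Liu's local
# theta type `X_v(μ, ε, χ_f)` by the character `χ_{f,v}` (`xThetaCM_localCenter`)

Cell hodgecm-mathlib (D-0151), FLOOR 0, crux item H413 = stmt-HodgeConjecture-24833, programme P2, socket 27455; pay-down line
`Cruxes/H413/Lines/F0_P2GR91NJacquet.lean` v1 (F0P2-plan (g7) CUT 14:14:14Z, director s561 (4)); its card asks for the audit K0 FIRST: «the centre `E¹_v`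
of `U(diag dV)(L⁺_v)` acts on `xThetaCM … ε v` by `χ_{f,v}(β)`» (a mismatch with the planner's Weil-representation heuristic `μ_v^{±1} χ_{f,v}^{±1}` would
mean the DICTIONARY (χ_f) of #76 is misstated).  Author B-p18 (g27) (K1 lead; K0 done first as the card prescribes).  THEOREMS ONLY; kernel lane
`--supports stmt-HodgeConjecture-24833 --as helper`.  HC_CM is proved only modulo the printed citations until rung 0 closes; nothing about them here.

VERDICT (kernel): the centre acts by `χ_{f,v}` EXACTLY — with NO `μ_v`-twist — and this is STRUCTURAL in the tree's construction: `xThetaCM` is the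
`χ_{f,v}`-coinvariant representation `TwistedCoinv.rep` of the local Weil representation `ω_v = omegaLoc v` of `U(diag dV ⊗ (ε))(L⁺_v)` under the
rank-one member `U((ε))(L⁺_v) = E¹_v` acting THROUGH THE CENTRE of the pair's ambient group (★ `localCenter`, the tree's realisation of the rank-one
dual pair [Liu2021, App. D §D.1 Step 3]), read on `U(diag dV)(L⁺_v)` along ★ `localLineInl` (`k ↦ k ⊗ 1`); and ★ `localLineInl_localCenter` says that the
centre of `U(diag dV)` lands on the SAME central elements.  So one and the same operator `ω_v(z)` carries both actions, and on the coinvariants it is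
the scalar `χ_{f,v}(z)` (★ `TwistedCoinv.rep_eq_smul_of_forall` with ratio `c = 1`): the splitting character `μ` enters `X_v` only through WHICH
splitting `s_v` of `U(diag dV ⊗ (ε))(L⁺_v)` is chosen (Kudla's `μ`-splitting ★ `chiLocalSplittingsCM`), never as a separate twist of the `U(W)`-action —
exactly Liu's convention `ω(μ, ε, χ) := (ω_{μ,ε})_{χ}` [Liu2021, Def. 4.11].  Consequence for the line: under `CenterCharSpec` (`ψθ(det u) = χ_{f,v}(u)·μ_v(det u)⁻¹`)
Rogawski's inducing character restricted to the centre is `μ_v(β)‖β‖^{1/2}ψθ(β) = χ_{f,v}(β)` — CONSISTENT with K0; no misstatement of #76's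
DICTIONARY (χ_f) is visible at the centre.

## References
* [Liu2021] Y. Liu, *Fourier–Jacobi cycles and arithmetic relative trace formula*, Camb. J. Math. 9 (2021) = arXiv:2102.11518: Def. 4.11 (l. 2090–2096),
  App. D §D.1 Step 3 (l. 5219–5221).
* [GelbartRogawski1991] S. Gelbart, J. Rogawski, Invent. Math. 105 (1991): §1.4 pp. 450–451, §5.1 (5.1.1), Lemma 5.1.2 p. 466.
* [MoeglinVignerasWaldspurger1987] C. Mœglin, M.-F. Vignéras, J.-L. Waldspurger, LNM 1291 (1987), Chap. 3 §IV (rank-one type I pairs: `U(W)` = centre).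
-/

set_option autoImplicit false
-- the mandated namespace has the single-problem summit's repeated segment (`HodgeConjecture.HodgeConjecture`)
set_option linter.dupNamespace false

noncomputable section

namespace Summit.HodgeConjecture.HodgeConjecture.Cruxes.H413.F0P2nXThetaCentralCharacter

open NumberField IsDedekindDomain MeasureTheory
open scoped Matrix
open Literature.NumberTheory Literature.NumberTheory.Automorphic Literature.NumberTheory.Automorphic.UnitaryGroup
open Literature.NumberTheory.Automorphic.IdeleClassGroup
open Literature.NumberTheory.Automorphic.Liu2021 Literature.NumberTheory.Automorphic.Liu2021.Def411WeilCarriers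
open Literature.NumberTheory.Automorphic.Liu2021.Def411WeilCarriersDoubling
open Literature.NumberTheory.GelbartRogawski1991 Literature.NumberTheory.GelbartRogawski1991.UnitaryDualPair
open Literature.NumberTheory.GelbartRogawski1991.UnitaryDualPair.WeilCoinv
open Literature.RepresentationTheory Literature.RepresentationTheory.Liu2021

set_option synthInstance.maxHeartbeats 400000 in
set_option maxHeartbeats 16000000 in
/-- **AUDIT K0 — the centre of `U(diag dV)(L⁺_v)` acts on `X_v(μ, ε, χ_f)` by `χ_{f,v}`.**  For a CM field `L`, a real non-zero diagonal frame `dV`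
of rank 3, `μ` conjugate symplectic, any character `χ_f` of `U(1)(𝔸_{L⁺,f})`, any line `ε ∈ (L⁺)ˣ` and any finite place `v` of `L⁺`: for every
`z ∈ U((ε))(L⁺_v) = E¹_v`, the central element `z·1₃ ∈ U(diag dV)(L⁺_v)` (★ `localCenter`) acts on Liu's local theta type `xThetaCM … μ hμ χf ε v` as the
SCALAR `χ_{f,v}(z)` (★ `localCharOfCenter … χf v z`) — no `μ_v`-twist.  Proof: ★ `localLineInl_localCenter` (the centre of `U(V)` IS the element through
which `U(W)` acts) and ★ `TwistedCoinv.rep_eq_smul_of_forall` at ratio `1`. [cite: Liu2021, Def. 4.11 (l. 2090–2096); App. D §D.1 Step 3 (l. 5219–5221)]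
[cite: GelbartRogawski1991, §5.1 (5.1.1), Lem 5.1.2 p. 466] -/
theorem xThetaCM_localCenter (L : Type) [Field L] [NumberField L] [IsCMField L] {n' : ℕ} (e₁ : Fin 3 × Fin 1 ≃ Fin n') (dV : Fin 3 → L)
    (hdV : ∀ i, IsCMField.complexConj L (dV i) = dV i) (hdV0 : ∀ i, dV i ≠ 0)
    (μ : Literature.NumberTheory.Automorphic.IdeleClassGroup L →ₜ* Circle) (hμ : IsConjugateSymplectic L μ)
    (χf : UnitaryGroup.finAdelicOne (↥(maximalRealSubfield L)) L (IsCMField.complexConj L) →* ℂˣ) (ε : (↥(maximalRealSubfield L))ˣ)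
    (v : HeightOneSpectrum (𝓞 ↥(maximalRealSubfield L)))
    (z : localPi L (IsCMField.complexConj L) 1 (JW (↥(maximalRealSubfield L)) L ε) v) :
    xThetaCM L e₁ dV hdV hdV0 μ hμ χf ε v
        (localCenter L (IsCMField.complexConj L) 3 (Matrix.diagonal dV) (JW (↥(maximalRealSubfield L)) L ε)
          (JW_apply_ne_zero (↥(maximalRealSubfield L)) L ε) v z) =
      ((localCharOfCenter (↥(maximalRealSubfield L)) L (IsCMField.complexConj L) (JW (↥(maximalRealSubfield L)) L ε)
          (JW_apply_ne_zero (↥(maximalRealSubfield L)) L ε) χf v z : ℂˣ) : ℂ) • (1 : Module.End ℂ _) := by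
  -- the abbreviation `xThetaCM` unfolded ONCE, as an explicit composition (definitional)
  rw [show xThetaCM L e₁ dV hdV hdV0 μ hμ χf ε v
        (localCenter L (IsCMField.complexConj L) 3 (Matrix.diagonal dV) (JW (↥(maximalRealSubfield L)) L ε)
          (JW_apply_ne_zero (↥(maximalRealSubfield L)) L ε) v z) =
      TwistedCoinv.rep (localCharOfCenter (↥(maximalRealSubfield L)) L (IsCMField.complexConj L) (JW (↥(maximalRealSubfield L)) L ε) (JW_apply_ne_zero (↥(maximalRealSubfield L)) L ε) χf v)
          ((chiLocalSplittingsCM L e₁ dV hdV hdV0 (toHeckeCharacter L μ) ((isOscillatorChar_toHeckeCharacter_iff μ).mpr hμ) ε).omegaLoc v)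
          (commute_omegaLoc_localCenter (↥(maximalRealSubfield L)) L (IsCMField.complexConj L) 3 e₁ (Matrix.diagonal dV)
            (JW (↥(maximalRealSubfield L)) L ε) (complexConj_imagUnit L) (imagUnit_ne_zero L) (imagUnit_mul_self L)
            (realDiagonal_isSymm L dV hdV) (isSymm_TW (↥(maximalRealSubfield L)) ε) (realDiagonal_map L dV hdV).symm
            (JW_eq (↥(maximalRealSubfield L)) L ε) (JW_apply_ne_zero (↥(maximalRealSubfield L)) L ε) (chiLocalSplittingsCM L e₁ dV hdV hdV0 (toHeckeCharacter L μ) ((isOscillatorChar_toHeckeCharacter_iff μ).mpr hμ) ε) v)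
        ((UnitaryGroup.localLineInl L (IsCMField.complexConj L) 3 e₁ (Matrix.diagonal dV) (JW (↥(maximalRealSubfield L)) L ε) v)
          (localCenter L (IsCMField.complexConj L) 3 (Matrix.diagonal dV) (JW (↥(maximalRealSubfield L)) L ε)
          (JW_apply_ne_zero (↥(maximalRealSubfield L)) L ε) v z)) from rfl]
  -- the centre of `U(diag dV)` is the element through which `U(W) = E¹_v` acts
  rw [localLineInl_localCenter]
  refine LinearMap.ext fun x => ?_
  rw [LinearMap.smul_apply, Module.End.one_apply,
    TwistedCoinv.rep_eq_smul_of_forall _ _ _ (c := (1 : ℂ)) (fun w => by rw [one_smul]; rfl) x, one_mul]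

end Summit.HodgeConjecture.HodgeConjecture.Cruxes.H413.F0P2nXThetaCentralCharacter

end
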